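import Mathlib
import Summits.RiemannHypothesis.RiemannHypothesis.Theorems.IntegerScrewExitAtomAssembly
import Summits.RiemannHypothesis.RiemannHypothesis.Theorems.IntegerScrewTiltMixture
import HarnessLib

/-!
# Route `IntegerScrew` — THEOREM B's three-way assembly on the `p`-free atom: flow + flat residual + tilt
# (CONTINUUM-LIMIT §25.10 (e) in the kernel)

Notation of `IntegerScrewExitAtomGreen`/`…ExitAtom`/`…ExitAtomAssembly`: `𝒜 = Nat.smoothNumbers p ∩ [1, R]`,
`W = 𝒜 ∩ (Q, R]`, `B = 𝒜 ∩ [1, Q]`, `ν^𝒜 = exitInflowAtom R Q p`, `c_𝒜 = exitMassRatioAtom R Q p`, `D_𝒜(g)` the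
atom's internal Dirichlet form, `H(θ) = Σ_{b∈B, b≤θ} 1/b`, `G(θ) = Σ_{b∈B, b≤θ} g(b)/b`.
`window_functional_sq_le_atom` priced the whole residual `Σ_B (ν^𝒜 − c_𝒜/b) g` by its χ²; on a true cell the
density `b·ν^𝒜(b)` carries an `O(1)` TILT (25.10 (b)), so the χ² is not small.  THEOREM B's remedy (25.10 (c)–(e)):
subtract an explicit PROFILE `T(b)` (any function; in 25.10, `T(b) = L/(log b + λ) − 1`), price the flattened
density `b·ν^𝒜(b) + T(b) − c_T` by χ² × Poincaré (PROP. 24.7 on the atom), and the profile itself by the mixture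
lemma (`IntegerScrewTiltMixture`: a centred BV density is a superposition of the atom's OWN windows `(θ, Q]`):

* `exit_residual_split` — `Σ_B ν^𝒜 g − c_𝒜·G(Q) = [Σ_B (1/b)(bν^𝒜 + T − c_T)·g] − [Σ_B (1/b)T·g − T̄·G(Q)]`
  with `c_T = Σ_B(ν^𝒜 + T/b)/H(Q)`, `T̄ = (Σ_B T/b)/H(Q)` (both brackets have mass zero);
* `flat_residual_sq_le` — `(Σ_B (1/b)(bν^𝒜 + T − c_T) g)² ≤ [Σ_B b(ν^𝒜 + T/b − c_T/b)²]·Σ_B (1/b)(g − g(1))²`;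
* **`window_functional_sq_le_atom_tilt`** — for `2 ≤ Q ≤ R`, `A ≥ 1`, `A(1 − (39/50)log R/log²(Q+1)) ≥ 1`,
  a Mertens constant `C`, every `p`, `g` and every profile `T`:
  `(Σ_W g/x − c_𝒜·G(Q))² ≤ 3·A²log²R(1/(2log²Q) − 1/(2log²R))·D_𝒜(g)`
  ` + 3·[Σ_B b(ν^𝒜(b) + T(b)/b − c_T/b)²]·⌊log₂Q⌋·C·D_𝒜(g)`
  ` + 3·(Σ_{1≤θ<Q} |T(θ+1) − T(θ)|·|H(θ)G(Q)/H(Q) − G(θ)|)²`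
  — the TRIANGLE-INEQUALITY form (the seminorm step of 25.10 (c)); the brackets are the window functionals of `B`
  (to be bounded by the window law ON `B`: `window_functional_sq_le` with `R := Q`, or PROP. 24.7 for the
  extreme thresholds);
  `window_functional_sq_le_atom_tilt_exp_five` (`C = e⁵`).

RH-free, elementary.  Nothing in this file bears on the truth of RH.
References: CONTINUUM-LIMIT §25.10 (rh-explicit A6-PIVOT); M. Suzuki, J. Lond. Math. Soc. (2) 108 (2023)
1448–1487 [Suzuki2023].
-/

noncomputable section

set_option linter.dupNamespace false -- D-0017: `Summit.<S>.<S>.…` is the designed namespace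

namespace Summit.RiemannHypothesis.RiemannHypothesis.Theorems.IntegerScrew

open Finset Real
open ArithmeticFunction (vonMangoldt)

/-! ### Atom sums as weighted interval sums -/

/-- The atom's harmonic weight on `[1, Q]`: `w(b) = 1/b` if `b` is `p`-free, else `0`.
[cite: Suzuki2023, §1 (the screw matrices S_M whose pivot/spectral theory this serves)] -/
def atomWeight (p b : ℕ) : ℝ := if b ∈ Nat.smoothNumbers p then 1 / (b : ℝ) else 0

/-- `Σ_{b ≤ θ, b p-free} f(b)/b = Σ_{b ≤ θ} w(b)·f(b)`. -/
theorem sum_filter_div_eq_sum_atomWeight (p θ : ℕ) (f : ℕ → ℝ) :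
    ∑ b ∈ (Icc 1 θ).filter (· ∈ Nat.smoothNumbers p), f b / b = ∑ b ∈ Icc 1 θ, atomWeight p b * f b := by
  rw [Finset.sum_filter]
  refine Finset.sum_congr rfl fun b _ => ?_
  unfold atomWeight
  split_ifs <;> ring

/-- `Σ_{b ≤ θ, b p-free} 1/b = Σ_{b ≤ θ} w(b)`. -/
theorem sum_filter_inv_eq_sum_atomWeight (p θ : ℕ) :
    ∑ b ∈ (Icc 1 θ).filter (· ∈ Nat.smoothNumbers p), (1 : ℝ) / b = ∑ b ∈ Icc 1 θ, atomWeight p b := by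
  have := sum_filter_div_eq_sum_atomWeight p θ (fun _ => 1)
  simpa using this

/-! ### Splitting the residual: flattened density + profile -/

/-- **The residual split.**  For every profile `T`:
`Σ_B ν^𝒜 g − c_𝒜·G(Q) = [Σ_B (ν^𝒜(b) + T(b)/b − c_T/b)·g(b)] − [Σ_B T(b)g(b)/b − T̄·G(Q)]`,
`c_T = Σ_B(ν^𝒜 + T/b)/H(Q)`, `T̄ = (Σ_B T/b)/H(Q)` (`1 ≤ Q ≤ R`). -/
theorem exit_residual_split {R Q : ℕ} (p : ℕ) (hQ : 1 ≤ Q) (hQR : Q ≤ R) (g T : ℕ → ℝ) :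
    ∑ b ∈ (Icc 1 Q).filter (· ∈ Nat.smoothNumbers p), exitInflowAtom R Q p b * g b -
        exitMassRatioAtom R Q p * ∑ b ∈ (Icc 1 Q).filter (· ∈ Nat.smoothNumbers p), g b / b =
      ∑ b ∈ (Icc 1 Q).filter (· ∈ Nat.smoothNumbers p),
          (exitInflowAtom R Q p b + T b / b -
            (∑ a ∈ (Icc 1 Q).filter (· ∈ Nat.smoothNumbers p), (exitInflowAtom R Q p a + T a / a)) /
              (∑ a ∈ (Icc 1 Q).filter (· ∈ Nat.smoothNumbers p), (1 : ℝ) / a) / b) * g b -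
        (∑ b ∈ (Icc 1 Q).filter (· ∈ Nat.smoothNumbers p), T b * (g b / b) -
          (∑ a ∈ (Icc 1 Q).filter (· ∈ Nat.smoothNumbers p), T a / a) /
            (∑ a ∈ (Icc 1 Q).filter (· ∈ Nat.smoothNumbers p), (1 : ℝ) / a) *
            ∑ b ∈ (Icc 1 Q).filter (· ∈ Nat.smoothNumbers p), g b / b) := by
  set B := (Icc 1 Q).filter (· ∈ Nat.smoothNumbers p) with hB
  have hH : (∑ a ∈ B, (1 : ℝ) / a) ≠ 0 := (sum_inv_bottom_atom_pos (Q := Q) p hQ).ne'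
  -- c_𝒜 · H = S = Σ_B ν^𝒜 (conservation)
  have hc : exitMassRatioAtom R Q p = (∑ a ∈ B, exitInflowAtom R Q p a) / ∑ a ∈ B, (1 : ℝ) / a := by
    unfold exitMassRatioAtom
    rw [hB, sum_exitInflowAtom_eq p hQ hQR]
  rw [hc]
  have e1 : ∑ b ∈ B, (exitInflowAtom R Q p b + T b / b -
      (∑ a ∈ B, (exitInflowAtom R Q p a + T a / a)) / (∑ a ∈ B, (1 : ℝ) / a) / b) * g b =
      ∑ b ∈ B, exitInflowAtom R Q p b * g b + ∑ b ∈ B, T b * (g b / b) -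
        (∑ a ∈ B, (exitInflowAtom R Q p a + T a / a)) / (∑ a ∈ B, (1 : ℝ) / a) * ∑ b ∈ B, g b / b := by
    rw [Finset.mul_sum, ← Finset.sum_add_distrib, ← Finset.sum_sub_distrib]
    exact Finset.sum_congr rfl fun b _ => by ring
  rw [e1, Finset.sum_add_distrib]
  field_simp
  ring

/-- **The flattened residual by Cauchy–Schwarz** (mass zero ⇒ recentre at `g(1)`):
`(Σ_B (ν^𝒜 + T/b − c_T/b)·g)² ≤ [Σ_B b·(ν^𝒜 + T/b − c_T/b)²]·Σ_B (1/b)(g − g(1))²` (`1 ≤ Q`). -/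
theorem flat_residual_sq_le {R Q : ℕ} (p : ℕ) (hQ : 1 ≤ Q) (g T : ℕ → ℝ) :
    (∑ b ∈ (Icc 1 Q).filter (· ∈ Nat.smoothNumbers p),
        (exitInflowAtom R Q p b + T b / b -
          (∑ a ∈ (Icc 1 Q).filter (· ∈ Nat.smoothNumbers p), (exitInflowAtom R Q p a + T a / a)) /
            (∑ a ∈ (Icc 1 Q).filter (· ∈ Nat.smoothNumbers p), (1 : ℝ) / a) / b) * g b) ^ 2 ≤
      (∑ b ∈ (Icc 1 Q).filter (· ∈ Nat.smoothNumbers p),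
          (b : ℝ) * (exitInflowAtom R Q p b + T b / b -
            (∑ a ∈ (Icc 1 Q).filter (· ∈ Nat.smoothNumbers p), (exitInflowAtom R Q p a + T a / a)) /
              (∑ a ∈ (Icc 1 Q).filter (· ∈ Nat.smoothNumbers p), (1 : ℝ) / a) / b) ^ 2) *
        ∑ b ∈ (Icc 1 Q).filter (· ∈ Nat.smoothNumbers p), (1 / (b : ℝ)) * (g b - g 1) ^ 2 := by
  set B := (Icc 1 Q).filter (· ∈ Nat.smoothNumbers p) with hB
  set cT := (∑ a ∈ B, (exitInflowAtom R Q p a + T a / a)) / (∑ a ∈ B, (1 : ℝ) / a) with hcT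
  have hH : (∑ a ∈ B, (1 : ℝ) / a) ≠ 0 := (sum_inv_bottom_atom_pos (Q := Q) p hQ).ne'
  -- mass zero
  have h0 : ∑ b ∈ B, (exitInflowAtom R Q p b + T b / b - cT / b) = 0 := by
    rw [Finset.sum_sub_distrib]
    have : ∑ b ∈ B, cT / (b : ℝ) = cT * ∑ b ∈ B, (1 : ℝ) / b := by
      rw [Finset.mul_sum]; exact Finset.sum_congr rfl fun b _ => by ring
    rw [this, hcT, div_mul_cancel₀ _ hH, sub_self]
  have hre : ∑ b ∈ B, (exitInflowAtom R Q p b + T b / b - cT / b) * g b =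
      ∑ b ∈ B, (exitInflowAtom R Q p b + T b / b - cT / b) * (g b - g 1) := by
    have : ∑ b ∈ B, (exitInflowAtom R Q p b + T b / b - cT / b) * (g b - g 1) =
        ∑ b ∈ B, (exitInflowAtom R Q p b + T b / b - cT / b) * g b -
          g 1 * ∑ b ∈ B, (exitInflowAtom R Q p b + T b / b - cT / b) := by
      rw [Finset.mul_sum, ← Finset.sum_sub_distrib]
      exact Finset.sum_congr rfl fun b _ => by ring
    rw [this, h0, mul_zero, sub_zero]
  rw [hre]
  refine Finset.sum_sq_le_sum_mul_sum_of_sq_le_mul B (fun b hb => ?_) (fun b hb => ?_)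
    (fun b hb => le_of_eq ?_)
  · have := (Finset.mem_Icc.1 (Finset.mem_filter.1 hb).1).1; positivity
  · positivity
  · have hb0 : (b : ℝ) ≠ 0 := by have := (Finset.mem_Icc.1 (Finset.mem_filter.1 hb).1).1; positivity
    field_simp

/-! ### The three-way assembly -/

/-- **THEOREM B, kernel skeleton with a tilt profile (CONTINUUM-LIMIT §25.10 (e)).**  For `2 ≤ Q ≤ R`,
the pointwise Green bound `Γ ≤ A log R/log x` on `(Q, R]`, a Mertens constant `C` (`Π_{q≤r}(1 − 1/q)⁻¹ ≤ C·log r` for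
primes `r ≤ R`), every `p`, every `g` and every profile `T : ℕ → ℝ`:
`(Σ_W g/x − c_𝒜·G(Q))² ≤ 3·[flow] + 3·[flattened χ²]·⌊log₂Q⌋·C·D_𝒜(g) + 3·(Σ_θ|ΔT(θ)|·|H(θ)G(Q)/H(Q) − G(θ)|)²`. -/
theorem window_functional_sq_le_atom_tilt {R Q : ℕ} (p : ℕ) (hQ : 2 ≤ Q) (hQR : Q ≤ R) {A : ℝ}
    (hΓU : ∀ x, Q < x → x ≤ R → exitGamma R Q x ≤ A * Real.log R / Real.log x) {C : ℝ}
    (hC : ∀ r : ℕ, r.Prime → r ≤ R → ∏ q ∈ (r + 1).primesBelow, (1 - 1 / (q : ℝ))⁻¹ ≤ C * Real.log r)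
    (g T : ℕ → ℝ) :
    (∑ x ∈ (Ioc Q R).filter (· ∈ Nat.smoothNumbers p), g x / x -
        exitMassRatioAtom R Q p * ∑ b ∈ (Icc 1 Q).filter (· ∈ Nat.smoothNumbers p), g b / b) ^ 2 ≤
      3 * (A ^ 2 * Real.log R ^ 2 * (1 / (2 * Real.log Q ^ 2) - 1 / (2 * Real.log R ^ 2))) *
          ∑ x ∈ (Icc 1 R).filter (· ∈ Nat.smoothNumbers p),
            (1 / (x : ℝ)) * ∑ n ∈ x.divisors, vonMangoldt n * (g x - g (x / n)) ^ 2 +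
      3 * ((∑ b ∈ (Icc 1 Q).filter (· ∈ Nat.smoothNumbers p),
            (b : ℝ) * (exitInflowAtom R Q p b + T b / b -
              (∑ a ∈ (Icc 1 Q).filter (· ∈ Nat.smoothNumbers p), (exitInflowAtom R Q p a + T a / a)) /
                (∑ a ∈ (Icc 1 Q).filter (· ∈ Nat.smoothNumbers p), (1 : ℝ) / a) / b) ^ 2) *
            ((Nat.log 2 Q : ℝ) * C)) *
          ∑ x ∈ (Icc 1 R).filter (· ∈ Nat.smoothNumbers p),
            (1 / (x : ℝ)) * ∑ n ∈ x.divisors, vonMangoldt n * (g x - g (x / n)) ^ 2 +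
      3 * (∑ θ ∈ Ico 1 Q, |T (θ + 1) - T θ| *
            |(∑ b ∈ (Icc 1 θ).filter (· ∈ Nat.smoothNumbers p), (1 : ℝ) / b) *
                (∑ b ∈ (Icc 1 Q).filter (· ∈ Nat.smoothNumbers p), g b / b) /
                (∑ b ∈ (Icc 1 Q).filter (· ∈ Nat.smoothNumbers p), (1 : ℝ) / b) -
              ∑ b ∈ (Icc 1 θ).filter (· ∈ Nat.smoothNumbers p), g b / b|) ^ 2 := by
  have hQ1 : 1 ≤ Q := by omega
  set B := (Icc 1 Q).filter (· ∈ Nat.smoothNumbers p) with hB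
  set D := ∑ x ∈ (Icc 1 R).filter (· ∈ Nat.smoothNumbers p),
    (1 / (x : ℝ)) * ∑ n ∈ x.divisors, vonMangoldt n * (g x - g (x / n)) ^ 2 with hD
  have hDnn : 0 ≤ D := Finset.sum_nonneg fun x _ => mul_nonneg (by positivity)
    (Finset.sum_nonneg fun n _ => mul_nonneg ArithmeticFunction.vonMangoldt_nonneg (sq_nonneg _))
  have hH : (∑ a ∈ B, (1 : ℝ) / a) ≠ 0 := (sum_inv_bottom_atom_pos (Q := Q) p hQ1).ne'
  -- the three pieces
  set F := ∑ x ∈ (Ioc Q R).filter (· ∈ Nat.smoothNumbers p), g x / x -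
    ∑ b ∈ B, exitInflowAtom R Q p b * g b with hF
  set cT := (∑ a ∈ B, (exitInflowAtom R Q p a + T a / a)) / (∑ a ∈ B, (1 : ℝ) / a) with hcT
  set R1 := ∑ b ∈ B, (exitInflowAtom R Q p b + T b / b - cT / b) * g b with hR1
  set R2 := ∑ b ∈ B, T b * (g b / b) - (∑ a ∈ B, T a / a) / (∑ a ∈ B, (1 : ℝ) / a) * ∑ b ∈ B, g b / b
    with hR2
  have hsplit : ∑ x ∈ (Ioc Q R).filter (· ∈ Nat.smoothNumbers p), g x / x -
      exitMassRatioAtom R Q p * ∑ b ∈ B, g b / b = F + (R1 - R2) := by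
    have := exit_residual_split (R := R) p hQ1 hQR g T
    rw [← hB] at this
    rw [hF, hR1, hR2, hcT, ← this]
    ring
  -- (1) the flow
  have hFsq : F ^ 2 ≤ A ^ 2 * Real.log R ^ 2 * (1 / (2 * Real.log Q ^ 2) - 1 / (2 * Real.log R ^ 2)) * D :=
    exit_flow_cauchy_schwarz_atom_explicit p hQ hQR hΓU g
  -- (2) the flattened residual
  set X := ∑ b ∈ B, (b : ℝ) * (exitInflowAtom R Q p b + T b / b - cT / b) ^ 2 with hX
  have hXnn : 0 ≤ X := Finset.sum_nonneg fun b _ => mul_nonneg (Nat.cast_nonneg _) (sq_nonneg _)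
  have hR1sq : R1 ^ 2 ≤ X * ((Nat.log 2 Q : ℝ) * C) * D := by
    have h1 : R1 ^ 2 ≤ X * ∑ b ∈ B, (1 / (b : ℝ)) * (g b - g 1) ^ 2 := by
      have := flat_residual_sq_le (R := R) p hQ1 g T
      rw [← hB] at this
      exact this
    -- PROP. 24.7 on the BOTTOM atom B = 𝒜 ∩ [1, Q] (Poincaré constant ⌊log₂Q⌋·C), then D_B ≤ D_𝒜
    have h3 := walk_poincare_mertens_dirichlet_atom Q p g (fun r hr hrQ => hC r hr (hrQ.trans hQR))
    rw [← hB] at h3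
    have hC0 : 0 ≤ C := by
      have h := hC 2 Nat.prime_two (hQ.trans hQR)
      have h1' := one_le_prod_primesBelow_inv (2 + 1)
      have hl : 0 < Real.log 2 := Real.log_pos (by norm_num)
      nlinarith
    have h4 : ∑ x ∈ B, (1 / (x : ℝ)) * ∑ n ∈ x.divisors, vonMangoldt n * (g x - g (x / n)) ^ 2 ≤ D := by
      refine Finset.sum_le_sum_of_subset_of_nonneg ?_ fun x _ _ => mul_nonneg (by positivity)
        (Finset.sum_nonneg fun n _ => mul_nonneg ArithmeticFunction.vonMangoldt_nonneg (sq_nonneg _))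
      intro x hx
      simp only [hB, Finset.mem_filter, Finset.mem_Icc] at hx ⊢
      exact ⟨⟨hx.1.1, hx.1.2.trans hQR⟩, hx.2⟩
    have hK : 0 ≤ (Nat.log 2 Q : ℝ) * C := mul_nonneg (Nat.cast_nonneg _) hC0
    calc R1 ^ 2 ≤ X * ∑ b ∈ B, (1 / (b : ℝ)) * (g b - g 1) ^ 2 := h1
      _ ≤ X * (((Nat.log 2 Q : ℝ) * C) * D) :=
          mul_le_mul_of_nonneg_left (h3.trans (mul_le_mul_of_nonneg_left h4 hK)) hXnn
      _ = X * ((Nat.log 2 Q : ℝ) * C) * D := by ring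
  -- (3) the profile, by the mixture identity with the atom weights and the triangle inequality
  set Br : ℕ → ℝ := fun θ => (∑ b ∈ (Icc 1 θ).filter (· ∈ Nat.smoothNumbers p), (1 : ℝ) / b) *
      (∑ b ∈ B, g b / b) / (∑ b ∈ B, (1 : ℝ) / b) - ∑ b ∈ (Icc 1 θ).filter (· ∈ Nat.smoothNumbers p), g b / b
    with hBr
  set M := (∑ θ ∈ Ico 1 Q, |T (θ + 1) - T θ| * |Br θ|) ^ 2 with hM
  have hR2sq : R2 ^ 2 ≤ M := by
    have hHw : (∑ b ∈ Icc 1 Q, atomWeight p b) ≠ 0 := by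
      rw [← sum_filter_inv_eq_sum_atomWeight]; exact hH
    have key := tilt_centred_eq_sum_windows (atomWeight p) g T hHw
    have eR2 : R2 = ∑ b ∈ Icc 1 Q, T b * atomWeight p b * g b -
        (∑ b ∈ Icc 1 Q, T b * atomWeight p b) / (∑ b ∈ Icc 1 Q, atomWeight p b) *
          ∑ b ∈ Icc 1 Q, atomWeight p b * g b := by
      rw [hR2, hB, sum_filter_div_eq_sum_atomWeight p Q g, sum_filter_inv_eq_sum_atomWeight p Q,
        sum_filter_div_eq_sum_atomWeight p Q T]
      have e1 : ∑ b ∈ (Icc 1 Q).filter (· ∈ Nat.smoothNumbers p), T b * (g b / b) =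
          ∑ b ∈ Icc 1 Q, T b * atomWeight p b * g b := by
        rw [Finset.sum_filter]
        refine Finset.sum_congr rfl fun b _ => ?_
        unfold atomWeight
        split_ifs <;> ring
      have e2 : ∑ b ∈ Icc 1 Q, atomWeight p b * T b = ∑ b ∈ Icc 1 Q, T b * atomWeight p b :=
        Finset.sum_congr rfl fun b _ => mul_comm _ _
      rw [e1, e2]
    have eBr : ∀ θ, Br θ = (∑ b ∈ Icc 1 θ, atomWeight p b) * (∑ b ∈ Icc 1 Q, atomWeight p b * g b) /
        (∑ b ∈ Icc 1 Q, atomWeight p b) - ∑ b ∈ Icc 1 θ, atomWeight p b * g b := by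
      intro θ
      simp only [hBr, hB]
      rw [sum_filter_div_eq_sum_atomWeight p Q g, sum_filter_inv_eq_sum_atomWeight p Q,
        sum_filter_inv_eq_sum_atomWeight p θ, sum_filter_div_eq_sum_atomWeight p θ g]
    have eR2' : R2 = ∑ θ ∈ Ico 1 Q, (T (θ + 1) - T θ) * Br θ := by
      rw [eR2, key]
      exact Finset.sum_congr rfl fun θ _ => by rw [eBr]
    have habs : |R2| ≤ ∑ θ ∈ Ico 1 Q, |T (θ + 1) - T θ| * |Br θ| := by
      rw [eR2']
      refine (Finset.abs_sum_le_sum_abs _ _).trans (le_of_eq (Finset.sum_congr rfl fun θ _ => abs_mul _ _))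
    rw [hM, ← sq_abs R2]
    exact pow_le_pow_left₀ (abs_nonneg R2) habs 2
  -- assemble: (F + (R1 − R2))² ≤ 3F² + 3R1² + 3R2²
  rw [hsplit]
  nlinarith [sq_nonneg (F - R1), sq_nonneg (F + R2), sq_nonneg (R1 + R2), hFsq, hR1sq, hR2sq]

/-- **THEOREM B, kernel skeleton with a tilt profile, unconditional Mertens constant `e⁵`.** -/
theorem window_functional_sq_le_atom_tilt_exp_five {R Q : ℕ} (p : ℕ) (hQ : 2 ≤ Q) (hQR : Q ≤ R) {A : ℝ}
    (hΓU : ∀ x, Q < x → x ≤ R → exitGamma R Q x ≤ A * Real.log R / Real.log x) (g T : ℕ → ℝ) :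
    (∑ x ∈ (Ioc Q R).filter (· ∈ Nat.smoothNumbers p), g x / x -
        exitMassRatioAtom R Q p * ∑ b ∈ (Icc 1 Q).filter (· ∈ Nat.smoothNumbers p), g b / b) ^ 2 ≤
      3 * (A ^ 2 * Real.log R ^ 2 * (1 / (2 * Real.log Q ^ 2) - 1 / (2 * Real.log R ^ 2))) *
          ∑ x ∈ (Icc 1 R).filter (· ∈ Nat.smoothNumbers p),
            (1 / (x : ℝ)) * ∑ n ∈ x.divisors, vonMangoldt n * (g x - g (x / n)) ^ 2 +
      3 * ((∑ b ∈ (Icc 1 Q).filter (· ∈ Nat.smoothNumbers p),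
            (b : ℝ) * (exitInflowAtom R Q p b + T b / b -
              (∑ a ∈ (Icc 1 Q).filter (· ∈ Nat.smoothNumbers p), (exitInflowAtom R Q p a + T a / a)) /
                (∑ a ∈ (Icc 1 Q).filter (· ∈ Nat.smoothNumbers p), (1 : ℝ) / a) / b) ^ 2) *
            ((Nat.log 2 Q : ℝ) * Real.exp 5)) *
          ∑ x ∈ (Icc 1 R).filter (· ∈ Nat.smoothNumbers p),
            (1 / (x : ℝ)) * ∑ n ∈ x.divisors, vonMangoldt n * (g x - g (x / n)) ^ 2 +
      3 * (∑ θ ∈ Ico 1 Q, |T (θ + 1) - T θ| *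
            |(∑ b ∈ (Icc 1 θ).filter (· ∈ Nat.smoothNumbers p), (1 : ℝ) / b) *
                (∑ b ∈ (Icc 1 Q).filter (· ∈ Nat.smoothNumbers p), g b / b) /
                (∑ b ∈ (Icc 1 Q).filter (· ∈ Nat.smoothNumbers p), (1 : ℝ) / b) -
              ∑ b ∈ (Icc 1 θ).filter (· ∈ Nat.smoothNumbers p), g b / b|) ^ 2 :=
  window_functional_sq_le_atom_tilt p hQ hQR hΓU (fun _ hr _ => prod_primesBelow_inv_le_exp_five_mul_log hr) g T

end Summit.RiemannHypothesis.RiemannHypothesis.Theorems.IntegerScrew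

end
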